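/-
Copyright (c) 2026 the pub-hodgecm-mathlib formalisation cell (harness21).  Prover seat hodgecm-mathlib-K2E1-p09 (g6), Track B ∕ K2-LIT, h413 =
`stmt-HodgeConjecture-24833`, ENGINE E1, campaign «EIS-R7-BL-SPH-3» (the `N = 3` clone), deal (30) of the dealer K2E1-plan (g6) 2026-09-04T10:00:18Z
(«(2b)₃-HN CHAIN» — FILE 3: the `OfUnfolding` edition of ★ FILE 2, twin of ★ p859116).
-/
import Summits.HodgeConjecture.HodgeConjecture.Theorems.K2E1TruncatedCuspDecayHNU3          -- ★ (2b)₃ the `𝓗_k`-wrapper at N = 3 (this seat, FILE 2)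
import Summits.HodgeConjecture.HodgeConjecture.Theorems.K2E1TruncatedCuspMassGrowthU3        -- ★ the letter `hM`₃ discharged (this seat, FILE 1 `exists_hM_three`)
import Summits.HodgeConjecture.HodgeConjecture.Theorems.K2E1SiegelStepDomainsU3             -- ★ (K2E1-p02 g2∕g6) B6₃: `exists_stepDomain_adele` = the letter `hdomX`; brings ★ `K2E1SiegelStepDomainsU2.exists_stepDomain` = `hdomY`
import HarnessLib

/-!
# K2·E1 — `K2E1TruncatedCuspDecayHNU3OfUnfolding` («EIS-R7-BL-SPH-3», (2b)₃-HN chain FILE 3): the cusp decay of `R(η ∗ η)` on `𝓗_k^cusp(Z_{c₁})` of `U(2,1)_{L∕L⁺}` MODULO THE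
# MEASURE LETTERS OF RECORD AND `hcnst`₃ ONLY

Track B ∕ K2-LIT, crux h413 = `stmt-HodgeConjecture-24833`, route of record `HCCMUnconditional`; cell `hodgecm-mathlib`, squad K2, ENGINE E1 (campaign «EIS-R7-BL», the BL-SPH-3
clone).  Prover seat `hodgecm-mathlib-K2E1-p09` (g6).  THEOREMS ONLY (no `def`, no `instance`, no notation, no named-fact hypothesis, no `sorry`; default heartbeats); lane
`--supports stmt-HodgeConjecture-24833 --as helper` (count-neutral).  Closes no socket.

`exists_forall_ae_norm_rightConvFun_le_three_of_unfolding` = ★ FILE 2 `exists_forall_ae_norm_rightConvFun_le_three` (the `hK1` of ★ `isCompactOperator_deltaShift_comp_subtypeL_HNcusp_of_cusp_decay`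
at `N = 3` for the honest `R(h)`, `h = η ∗ η`) with THREE of its four letters DISCHARGED: `hdomX` by ★ `K2E1SiegelStepDomainsU3.exists_stepDomain_adele`, `hdomY` by ★
`K2E1SiegelStepDomainsU2.exists_stepDomain` (the centre step domains of the CM pair) and `hM` by ★ FILE 1 `K2E1TruncatedCuspMassGrowthU3.exists_hM_three`.  What remains displayed: the Haar
hypotheses on `ν_G` (inversion- and right-invariant), the measure letters of record `hβ` (covering weight of `B(F)♯`) and `hμZ` (unfolding `μZ = π_*(β ν_G)`), the unipotent datum
`(νN, 𝓕N)`, and the cuspidality letter `hcnst`₃ in the ENGINE₃ currency (owner K2-defs1 FILE M ∘ (ii)₃) — the `N = 3` twin of ★ p859116.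
[cite: BernsteinLapid2019, §4 Claim 5 (p. 10)] [cite: MoeglinWaldspurger1995, I.2.13]
HONEST LABEL: HC_CM is proved only modulo the 7 printed citations (2 remaining named inputs: hLiu418 = `stmt-HodgeConjecture-24832`, h413 = `stmt-HodgeConjecture-24833`) until rung 0
closes; this file asserts no named fact and closes no socket; count-neutral.
-/

noncomputable section

set_option autoImplicit false

set_option linter.dupNamespace false

open NumberField IsDedekindDomain MeasureTheory Measure Set Function Filter Topology
open scoped NNReal MatrixGroups Pointwise ENNReal Classical

namespace Summit.HodgeConjecture.HodgeConjecture.Cruxes.H413.K2E1TruncatedCuspDecayHNU3OfUnfolding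

open Literature.MeasureTheory.Group Literature.NumberTheory.Automorphic Literature.NumberTheory.Automorphic.UnitaryGroup AdelicGroupData
open Summit.HodgeConjecture.HodgeConjecture.Cruxes.H413.K2E1BLBorelSpacesU2Defs
open Summit.HodgeConjecture.HodgeConjecture.Cruxes.H413.K2E1BLBorelOperatorsU2Defs (rightConvFun)
open Summit.HodgeConjecture.HodgeConjecture.Cruxes.H413.K2E1TruncatedCuspDecayHNU3 (exists_forall_ae_norm_rightConvFun_le_three)
open Summit.HodgeConjecture.HodgeConjecture.Cruxes.H413.K2E1TruncatedCuspMassGrowthU3 (exists_hM_three)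
open Summit.HodgeConjecture.HodgeConjecture.Cruxes.H413.K2E1SiegelStepDomainsU3 (exists_stepDomain_adele)
open Summit.HodgeConjecture.HodgeConjecture.Cruxes.H413.K2E1SiegelStepDomainsU2 (exists_stepDomain)

variable (L : Type) [Field L] [NumberField L] [IsCMField L]

/-- **K1₃-L² MODULO THE MEASURE LETTERS OF RECORD AND `hcnst`₃.**  CM pair `L∕L⁺`, `G = U(2,1)_{L∕L⁺}`; `ν_G` Haar, inversion- and right-invariant; `ν_X`, `ν_Y` Haar on `𝔸_L`, `𝔸_L⁻`; `ν_N`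
Haar on `N(𝔸)` with ONE relatively compact fundamental domain `𝓕N`; `hβ`, `hμZ` the measure letters of record (D2); `η₀` a test function on `GL₃(𝔸_L)`, `η = η₀|_{G(𝔸)}`, `h = S_η η = η ∗ η`;
`hcnst` the cuspidality letter in the engine₃ currency.  THEN for every `m ≥ 0` there are `c⋆` and `C ≥ 0` with, for all `c₀ ≥ c⋆` and all `f ∈ 𝓗_k^cusp(Z_{c₁})`:
**`‖R(h)f(z)‖ ≤ C·‖f‖·HZ(z)^{−m}` for `HZ^{−2k}μZ|_{Z_{c₀}}`-a.e. `z`** (★ FILE 2 with `hdomX := exists_stepDomain_adele`, `hdomY := exists_stepDomain`, `hM := exists_hM_three`).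
[cite: BernsteinLapid2019, §4 Claim 5 (p. 10)] [cite: MoeglinWaldspurger1995, I.2.13] -/
theorem exists_forall_ae_norm_rightConvFun_le_three_of_unfolding
    [MeasurableSpace (quasiSplit (↥(maximalRealSubfield L)) L (IsCMField.complexConj L) 3).Adelic] [BorelSpace (quasiSplit (↥(maximalRealSubfield L)) L (IsCMField.complexConj L) 3).Adelic]
    (νG : Measure (quasiSplit (↥(maximalRealSubfield L)) L (IsCMField.complexConj L) 3).Adelic) [νG.IsHaarMeasure] [νG.IsInvInvariant] [νG.IsMulRightInvariant]
    [MeasurableSpace (AdeleRing (𝓞 L) L)] [BorelSpace (AdeleRing (𝓞 L) L)]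
    (νX : Measure (AdeleRing (𝓞 L) L)) [νX.IsAddHaarMeasure]
    (νY : Measure ↥(traceZeroAdele (↥(maximalRealSubfield L)) L (IsCMField.complexConj L))) [νY.IsAddHaarMeasure]
    [MeasurableSpace ↥(adelicUnipotent (↥(maximalRealSubfield L)) L (IsCMField.complexConj L) 3)] [BorelSpace ↥(adelicUnipotent (↥(maximalRealSubfield L)) L (IsCMField.complexConj L) 3)]
    (νN : Measure ↥(adelicUnipotent (↥(maximalRealSubfield L)) L (IsCMField.complexConj L) 3)) [νN.IsHaarMeasure]
    {𝓕N : Set ↥(adelicUnipotent (↥(maximalRealSubfield L)) L (IsCMField.complexConj L) 3)}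
    (h𝓕N : IsFundamentalDomain ↥(rationalUnipotent (↥(maximalRealSubfield L)) L (IsCMField.complexConj L) 3) 𝓕N νN) (h𝓕Nc : IsCompact (closure 𝓕N))
    {β : (quasiSplit (↥(maximalRealSubfield L)) L (IsCMField.complexConj L) 3).Adelic → ℝ≥0∞}
    (hβ : IsCoveringWeight ↥((arithmeticBorel (↥(maximalRealSubfield L)) L (IsCMField.complexConj L) 3).map (quasiSplit (↥(maximalRealSubfield L)) L (IsCMField.complexConj L) 3).arithmeticSubgroup.subtype) β)
    {μZ : Measure (borelQuotient (↥(maximalRealSubfield L)) L (IsCMField.complexConj L) 3)}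
    (hμZ : ∀ f : borelQuotient (↥(maximalRealSubfield L)) L (IsCMField.complexConj L) 3 → ℝ≥0∞, Measurable f →
      ∫⁻ z, f z ∂μZ = ∫⁻ g, β g * f (toBorelQuotient (↥(maximalRealSubfield L)) L (IsCMField.complexConj L) 3 g) ∂νG)
    {η₀ : GL (Fin 3) (AdeleRing (𝓞 L) L) → ℝ} (hη₀ : IsTestFunctionGL 3 L η₀)
    (k : ℕ) (c₁ : ℝ≥0) (cP : ℝ≥0)
    (hcnst : ∀ f : ↥(HNcusp (↥(maximalRealSubfield L)) L (IsCMField.complexConj L) 3 k c₁ μZ), ∀ᵐ g ∂νG, cP < borelHeight g →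
      borelConstantTerm νN 𝓕N (fun x : (quasiSplit (↥(maximalRealSubfield L)) L (IsCMField.complexConj L) 3).Adelic =>
        {z : borelQuotient (↥(maximalRealSubfield L)) L (IsCMField.complexConj L) 3 | c₁ < borelQuotHeight (↥(maximalRealSubfield L)) L (IsCMField.complexConj L) 3 z}.indicator
          ((f : HN (↥(maximalRealSubfield L)) L (IsCMField.complexConj L) 3 k c₁ μZ) : borelQuotient (↥(maximalRealSubfield L)) L (IsCMField.complexConj L) 3 → ℂ)
          (toBorelQuotient (↥(maximalRealSubfield L)) L (IsCMField.complexConj L) 3 x)) g = 0)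
    {m : ℝ} (hm : 0 ≤ m) :
    ∃ (cstar : ℝ≥0) (C : ℝ), 0 ≤ C ∧ ∀ c₀ : ℝ≥0, cstar ≤ c₀ → ∀ f : ↥(HNcusp (↥(maximalRealSubfield L)) L (IsCMField.complexConj L) 3 k c₁ μZ),
      ∀ᵐ z ∂(weightedTruncMeasure (↥(maximalRealSubfield L)) L (IsCMField.complexConj L) 3 k c₀ μZ),
        ‖rightConvFun (↥(maximalRealSubfield L)) L (IsCMField.complexConj L) 3 νG
            (fun y => orbitalSmoothing νG (fun g : (quasiSplit (↥(maximalRealSubfield L)) L (IsCMField.complexConj L) 3).Adelic => ((η₀ (adelicVal (↥(maximalRealSubfield L)) L (IsCMField.complexConj L) 3 ((StdForm.antidiagonal 3).over L) g) : ℝ) : ℂ))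
              (fun g : (quasiSplit (↥(maximalRealSubfield L)) L (IsCMField.complexConj L) 3).Adelic => ((η₀ (adelicVal (↥(maximalRealSubfield L)) L (IsCMField.complexConj L) 3 ((StdForm.antidiagonal 3).over L) g) : ℝ) : ℂ)) y)
            ((f : HN (↥(maximalRealSubfield L)) L (IsCMField.complexConj L) 3 k c₁ μZ) : borelQuotient (↥(maximalRealSubfield L)) L (IsCMField.complexConj L) 3 → ℂ) z‖ ≤
          C * ‖f‖ * ((borelQuotHeight (↥(maximalRealSubfield L)) L (IsCMField.complexConj L) 3 z : ℝ)) ^ (-m) :=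
  exists_forall_ae_norm_rightConvFun_le_three L νG νX νY νN h𝓕N h𝓕Nc (fun c hc0 => exists_stepDomain_adele L c hc0 νX) (fun c hc0 => exists_stepDomain L c hc0 νY)
    hη₀ k c₁ μZ cP hcnst (exists_hM_three νG hβ hμZ k c₁) hm

end Summit.HodgeConjecture.HodgeConjecture.Cruxes.H413.K2E1TruncatedCuspDecayHNU3OfUnfolding

end
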